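/-
Copyright (c) 2026 the pub-hodgecm-mathlib formalisation cell (harness21).  Prover seat hodgecm-mathlib-LH4-p04 (g9), req620 Track A «(D-RAM) FOUR-FRAME» squad
((β₂) road (R-36), β₂-BOARD v2 row (L-Σ), brick (L-Σ-3B) ED. 4-0b: the two halves of the d = 2 window ledger — one literal at a time; pure `ℤ`-algebra), 2026-09-05.
-/
import Mathlib.Algebra.BigOperators.Ring.Finset
import Mathlib.Algebra.BigOperators.Intervals
import Mathlib.Tactic.LinearCombination
import Mathlib.Tactic.Ring
import Summits.HodgeConjecture.HodgeConjecture.Theorems.K2LiuSplitTwoDepthWitnessConstant   -- ★ `geom_shift`: `(q − 1)·Σ_{i<k} q^{i+1} = q^{k+1} − q` (reused)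
import HarnessLib

/-!
# Crux `H413`, line LH4 «(D-RAM) FOUR-FRAME» — (β₂) road, brick (L-Σ-3B) ED. 4-0b: «THE d = 2 WINDOW TOTAL, ONE LITERAL AT A TIME» (pure `ℤ`-algebra, no field, no lattice)

Cell `hodgecm-mathlib` (D-0151), FLOOR 0, crux item H413 = `stmt-HodgeConjecture-24833`, route of record `HCCMUnconditional`; squad F0∕P3c∕LH4; lane
`--supports stmt-HodgeConjecture-24833 --as helper` (count-neutral).  THEOREMS ONLY (no `def`, no instance, no notation, no `sorry`, default heartbeats).
WHY.  ★ p863215 `window_ledger_two` balances the d = 2 window ledger of the even row across the two literals at once.  The socket ‹WIN.letter.v1› (β₂ WORD #20; binder `hwin`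
of `core2E_of_win`) is ONE-LITERAL — the window total of a literal is `c·X(b,b)` (isotropic `h`) resp. `−c·X(b,b)` (anisotropic), `c = q − 1` at `δ = 4` and `−(q + 1)` beyond —
so ED. 4a needs the ledger ONE HALF AT A TIME, on the same abstract cells and with the same dealt row shapes as ★ `window_ledger_two`:
* `hwindow_two` — hyperbolic half: (REL-CLEAN) `∀ i, 1 ≤ i → i + 2 ≤ K → n 0 * X i = n i * X 0`, (REL-FLIPT) `3 ≤ K → (q − 1) * n 0 * X (K − 1) = −(n (K − 1) * X 0)`,
  (REL-B2d) `K = 2 → n 0 * X 1 = n 1 * X 0`, (TERM) `X K = 0`, (SIZES) `n 1 = (q − 2) * n 0`, `n i = 2 * (q − 1) * q ^ (i − 1) * n 0` (`2 ≤ i ≤ K`), `n 0 ≠ 0`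
  ⊢ `Σ_{i < K+1} X i = (if K = 2 then q − 1 else −(q + 1)) * X 0`;
* `awindow_two` — anisotropic half: (REL-CLEAN) `3 ≤ K → n0 * XA 1 = nA 1 * XA 0`, (REL-S2d) `K = 2 → n0 * XA 1 = −(nA 1 * XA 0)`, (SIZE-A) `nA 1 = q * n0`, `n0 ≠ 0`
  ⊢ `Σ_{i < min (K+1) 2} XA i = −(if K = 2 then q − 1 else −(q + 1)) * XA 0`.
HONEST LABEL.  Arithmetic only; nothing printed is asserted; the rows, ‹WIN›, ‹CORE›, β₂ stay HYPOTHESES; d ≥ 3 and odd δ NOT covered; `HC_CM` is proved only modulo the 7 printed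
citations (2 remaining named inputs: hLiu418 = `stmt-HodgeConjecture-24832`, h413 = `stmt-HodgeConjecture-24833`) until rung 0 closes.
References: [Kottwitz1986BaseChangeUnits] R. E. Kottwitz, Compositio Math. 60 (1986), §1 pp. 240–241 · [Rogawski1990] Ann. of Math. Stud. 123, §4.9 Prop. 4.9.1 (b) p. 55, Lemma 4.9.3 p. 56.
-/

set_option autoImplicit false

namespace Summit.HodgeConjecture.HodgeConjecture.Cruxes.H413.F0P3cDyRamWindowLedgerTwoHalves

open Finset

/-- **THE HYPERBOLIC HALF OF THE d = 2 WINDOW LEDGER**: `Σ_{i < K+1} X i = (q − 1)·X 0` at `K = 2` and `−(q + 1)·X 0` at `K ≥ 3` (abstract cells; hypotheses = the dealt row shapes).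
[cite: Kottwitz1986BaseChangeUnits, §1 pp. 240–241] [cite: Rogawski1990, §4.9 Prop. 4.9.1 (b) p. 55, Lemma 4.9.3 p. 56] -/
theorem hwindow_two (X n : ℕ → ℤ) (q : ℤ) (K : ℕ) (hK : 2 ≤ K) (hq : 2 ≤ q) (hn0 : n 0 ≠ 0)
    (hclean : ∀ i, 1 ≤ i → i + 2 ≤ K → n 0 * X i = n i * X 0)
    (hflip : 3 ≤ K → (q - 1) * n 0 * X (K - 1) = -(n (K - 1) * X 0))
    (hB : K = 2 → n 0 * X 1 = n 1 * X 0) (hterm : X K = 0)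
    (hn1 : n 1 = (q - 2) * n 0) (hn : ∀ i, 2 ≤ i → i ≤ K → n i = 2 * (q - 1) * q ^ (i - 1) * n 0) :
    ∑ i ∈ range (K + 1), X i = (if K = 2 then q - 1 else -(q + 1)) * X 0 := by
  have hq1 : (q - 1) ≠ 0 := fun h => by omega
  -- the first tower cell `c = 2`: `X 1 = (q − 2)·X 0`
  have hX1 : X 1 = (q - 2) * X 0 := by
    have h1 : n 0 * X 1 = n 1 * X 0 := by
      rcases Nat.lt_or_ge K 3 with h | h
      · exact hB (by omega)
      · exact hclean 1 le_rfl (by omega)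
    refine mul_left_cancel₀ hn0 ?_
    rw [h1, hn1]; ring
  rcases Nat.lt_or_ge K 3 with hK2 | hK3
  · -- `K = 2` (δ = 4): `D, B, terminal`
    obtain rfl : K = 2 := by omega
    rw [if_pos rfl, sum_range_succ, sum_range_succ, sum_range_succ, sum_range_zero, hterm, hX1]
    ring
  · -- `K = k + 3 ≥ 3` (δ ≥ 6): `D, B, clean towers, flip tower, terminal`
    obtain ⟨k, rfl⟩ : ∃ k, K = k + 3 := ⟨K - 3, by omega⟩
    have hXf : X (k + 2) = -(2 * q ^ (k + 1) * X 0) := by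
      have hf : (q - 1) * n 0 * X (k + 3 - 1) = -(n (k + 3 - 1) * X 0) := hflip hK3
      rw [(by omega : k + 3 - 1 = k + 2), hn (k + 2) (by omega) (by omega), (by omega : k + 2 - 1 = k + 1)] at hf
      refine mul_left_cancel₀ (mul_ne_zero hq1 hn0) ?_
      rw [hf]; ring
    have hXc : ∀ i ∈ range k, X (i + 1 + 1) = 2 * (q - 1) * q ^ (i + 1) * X 0 := fun i hi => by
      have hik := mem_range.1 hi
      have hc := hclean (i + 1 + 1) (by omega) (by omega)
      rw [hn (i + 1 + 1) (by omega) (by omega), Nat.add_sub_cancel] at hc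
      refine mul_left_cancel₀ hn0 ?_
      rw [hc]; ring
    have hsum : ∑ i ∈ range k, X (i + 1 + 1) = 2 * X 0 * (q ^ (k + 1) - q) := by
      rw [sum_congr rfl hXc, ← Summit.HodgeConjecture.HodgeConjecture.Cruxes.HLiu418.K2LiuSplitTwoDepthWitnessConstant.geom_shift q k, mul_sum, mul_sum]
      exact sum_congr rfl fun i _ => by ring
    rw [if_neg (by omega : k + 3 ≠ 2), sum_range_succ, sum_range_succ, sum_range_succ', sum_range_succ', zero_add, hsum, hterm, hXf, hX1]
    ring

/-- **THE ANISOTROPIC HALF OF THE d = 2 WINDOW LEDGER**: `XA 0 + XA 1 = −(q − 1)·XA 0` at `K = 2` (the special cell `S = −q·XA 0`), `(q + 1)·XA 0` at `K ≥ 3` (clean `q·XA 0`) —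
written as `Σ_{i < min (K+1) 2} XA i = −c·XA 0` with ‹WIN›'s coefficient `c`. [cite: Kottwitz1986BaseChangeUnits, §1 pp. 240–241] [cite: Rogawski1990, §4.9 Lemma 4.9.3 p. 56] -/
theorem awindow_two (XA nA : ℕ → ℤ) (n0 q : ℤ) (K : ℕ) (hK : 2 ≤ K) (hn0 : n0 ≠ 0)
    (hAclean : 3 ≤ K → n0 * XA 1 = nA 1 * XA 0) (hS : K = 2 → n0 * XA 1 = -(nA 1 * XA 0)) (hnA : nA 1 = q * n0) :
    ∑ i ∈ range (min (K + 1) 2), XA i = -(if K = 2 then q - 1 else -(q + 1)) * XA 0 := by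
  rw [min_eq_right (by omega : 2 ≤ K + 1), sum_range_succ, sum_range_one]
  rcases Nat.lt_or_ge K 3 with hK2 | hK3
  · obtain rfl : K = 2 := by omega
    have hXA1 : XA 1 = -(q * XA 0) := by
      refine mul_left_cancel₀ hn0 ?_
      rw [hS rfl, hnA]; ring
    rw [if_pos rfl, hXA1]; ring
  · have hXA1 : XA 1 = q * XA 0 := by
      refine mul_left_cancel₀ hn0 ?_
      rw [hAclean hK3, hnA]; ring
    rw [if_neg (by omega : K ≠ 2), hXA1]; ring

end Summit.HodgeConjecture.HodgeConjecture.Cruxes.H413.F0P3cDyRamWindowLedgerTwoHalves
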